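import Mathlib.RingTheory.Localization.Ideal
import Mathlib.RingTheory.Localization.AtPrime.Basic
import Mathlib.RingTheory.Ideal.Quotient.Operations
import HarnessLib

/-!
# Localization commutes with the quotient by a principal ideal: `A_Q/(u) ≅ (A/(u))_{Q/(u)}`

Support file for crux stmt-ResolutionOfSingularities-15315 (`FrobeniusLadder.FInjectiveMacaulayfication`,
line `Sketch`, lead seat c4, cycle 5, wave 1): stub `stub_quotLocalizationIso` of the §6 BLOW-UP GLUE (E6)
package. In the line, `A` is a blow-up chart ring and `u = a/1` cuts out the exceptional divisor `E`, so
`A/(u)` is the chart ring of `E`; the certified clause on the local rings `(A/(u))_{Q'}` of `E` is transported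
along the isomorphism of this file to `A_Q/(u)`, where the deformation engine lifts it to `A_Q`.

What is proved, for a commutative ring `A`, `u : A`, a prime `Q` of `A` and a prime `Q'` of `A/(u)` with
`Q' ∩ A = Q` (i.e. `Q'.comap (Ideal.Quotient.mk (u)) = Q`, which forces `u ∈ Q` and `Q' = Q/(u)`):

* `algebraMapSubmonoid_primeCompl_comap` — the image of the submonoid `A ∖ Q` in `A/(u)` is exactly
  `(A/(u)) ∖ Q'` (lift elements along the surjection `A → A/(u)`).
* `stub_quotLocalizationIso` — the registered form:
  `A_Q ⧸ (u/1) ≃+* (A/(u))_{Q'}`. Mathlib knows (instance at the end of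
  `Mathlib/RingTheory/Localization/Ideal.lean`, via `IsLocalization.of_surjective`) that
  `S ⧸ I·S` is the localization of `A ⧸ I` at the image of the submonoid whenever `S` is the localization of
  `A` at it; with `S = A_Q`, `I = (u)` and the previous bullet this says that `A_Q ⧸ (u)·A_Q` is a
  localization of `A/(u)` at `Q'.primeCompl`, whence it is isomorphic to `Localization.AtPrime Q'`
  (`IsLocalization.algEquiv`, uniqueness of localizations); finally `(u)·A_Q = (u/1)`
  (`Ideal.map_span`, `Ideal.quotEquivOfEq`).

References: folklore ("localization is exact / commutes with quotients"); for context only see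
Atiyah–Macdonald, *Introduction to Commutative Algebra*, Prop. 3.11, and the Stacks project, Tag 00CT.
-/

-- single-problem summit: the doubled namespace component is forced
set_option linter.dupNamespace false

namespace Summit.ResolutionOfSingularities.ResolutionOfSingularities.Theorems.FInjectiveMacaulayfication.QuotLocalizationIso

-- adapted from Literature/RingTheory/OrderOfVanishing/NormOrd.lean (`algebraMapSubmonoid_primeCompl_comap`,
-- stated there for maximal ideals); kept local to stay on the three Mathlib imports of this glue file.
/-- **The complement of `Q = Q' ∩ A` maps onto the complement of `Q'`.** For an ideal `I` of `A` and a
prime `Q'` of `A ⧸ I`, the image in `A ⧸ I` of the submonoid `A ∖ (Q'.comap mk)` is `(A ⧸ I) ∖ Q'`: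
one inclusion is the definition of `comap`, the other lifts along the surjection `Ideal.Quotient.mk I`.
[folklore] -/
theorem algebraMapSubmonoid_primeCompl_comap {A : Type*} [CommRing A] (I : Ideal A)
    (Q' : Ideal (A ⧸ I)) [Q'.IsPrime] :
    Algebra.algebraMapSubmonoid (A ⧸ I) (Q'.comap (Ideal.Quotient.mk I)).primeCompl =
      Q'.primeCompl := by
  ext x
  refine ⟨?_, fun hx => ?_⟩
  · rintro ⟨y, hy, rfl⟩
    exact hy
  · obtain ⟨y, rfl⟩ := Ideal.Quotient.mk_surjective x
    exact ⟨y, hx, rfl⟩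

/-- **Localization commutes with the quotient by `(u)`** (registered stub `stub_quotLocalizationIso` of the
E6 blow-up glue): for a prime `Q` of `A` and a prime `Q'` of `A/(u)` lying over it
(`Q'.comap mk = Q`, i.e. `Q' = Q/(u)`), there is a ring isomorphism `A_Q ⧸ (u/1) ≃+* (A/(u))_{Q'}`.
Proof: `A_Q ⧸ (u)·A_Q` is the localization of `A/(u)` at the image of `A ∖ Q` (Mathlib instance built on
`IsLocalization.of_surjective`), that image is `Q'.primeCompl` (`algebraMapSubmonoid_primeCompl_comap`),
so uniqueness of localizations (`IsLocalization.algEquiv`) gives `A_Q ⧸ (u)·A_Q ≃ Localization.AtPrime Q'`,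
and `(u)·A_Q = (u/1)` (`Ideal.map_span`). [folklore] -/
theorem stub_quotLocalizationIso : ∀ (A : Type) [CommRing A] (u : A) (Q : Ideal A) [Q.IsPrime]
    (Q' : Ideal (A ⧸ Ideal.span {u})) [Q'.IsPrime], Q'.comap (Ideal.Quotient.mk (Ideal.span {u})) = Q →
    Nonempty ((Localization.AtPrime Q ⧸ Ideal.span {algebraMap A (Localization.AtPrime Q) u}) ≃+*
      Localization.AtPrime Q') := by
  intro A _ u Q _ Q' _ hQ'
  subst hQ'
  -- `A_Q ⧸ (u)·A_Q` is the localization of `A/(u)` at `Q'.primeCompl`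
  have hL : IsLocalization Q'.primeCompl
      (Localization.AtPrime (Q'.comap (Ideal.Quotient.mk (Ideal.span {u}))) ⧸
        (Ideal.span {u}).map (algebraMap A
          (Localization.AtPrime (Q'.comap (Ideal.Quotient.mk (Ideal.span {u})))))) := by
    rw [← algebraMapSubmonoid_primeCompl_comap (Ideal.span {u}) Q']
    infer_instance
  -- `(u/1) = (u)·A_Q`
  have h : Ideal.span {algebraMap A
      (Localization.AtPrime (Q'.comap (Ideal.Quotient.mk (Ideal.span {u})))) u} =
      (Ideal.span {u}).map (algebraMap A
        (Localization.AtPrime (Q'.comap (Ideal.Quotient.mk (Ideal.span {u}))))) := by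
    rw [Ideal.map_span, Set.image_singleton]
  exact ⟨(Ideal.quotEquivOfEq h).trans
    (IsLocalization.algEquiv Q'.primeCompl
      (Localization.AtPrime (Q'.comap (Ideal.Quotient.mk (Ideal.span {u}))) ⧸
        (Ideal.span {u}).map (algebraMap A
          (Localization.AtPrime (Q'.comap (Ideal.Quotient.mk (Ideal.span {u}))))))
      (Localization.AtPrime Q')).toRingEquiv⟩

end Summit.ResolutionOfSingularities.ResolutionOfSingularities.Theorems.FInjectiveMacaulayfication.QuotLocalizationIso
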